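import Mathlib

/-!
# CM types on a group with a central involution: right translation, right stabiliser, descent

Combinatorial core of `proofs/p6-weil-classes.md`, Lemma 6.5 (cell pub-hodge-repro0).

Dictionary. `Γ` plays the role of `Gal(F/ℚ)` for a CM field `F` Galois over `ℚ`, and `c` the role
of complex conjugation (a central element; `c * c = 1` is never needed below). A *CM type* on `F` is
a subset `φ ⊆ Γ` containing exactly one element of each pair `{τ, c * τ}`; this is `IsCMType c φ`.
Right translation `φ ↦ φ * γ` is the operation `φ_s ↦ φ_s ∘ γ` of Lemma 6.3/6.5; its stabiliser
`rstab φ` is the subgroup `H` there, and the left-coset space `Γ ⧸ rstab φ` is `Hom(F^H, ℂ)`.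

Results (all unconditional):
* `isCMType_rtrans`   — right translates of a CM type are CM types;
* `c_notMem_rstab_of_isCMType` — `c ∉ rstab φ` when `c` is central (the conjugate type `c * φ` is
  disjoint from `φ`);
* `mem_of_mem_rstab`, `mem_iff_of_rel` — `φ` is a union of left cosets of `rstab φ`;
* `isCMType_descend` — the image of `φ` in `Γ ⧸ rstab φ` is again a CM type for the action of `c`
  by left multiplication (this is the type `Φ₀` on the fixed field `F^H` in Lemma 6.5).
-/

namespace HodgeRepro0.CMType

/-- `IsCMTypeOn σ φ`: for every `x`, exactly one of `x`, `σ x` lies in `φ`. -/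
def IsCMTypeOn {X : Type*} (σ : X → X) (φ : Set X) : Prop := ∀ x, x ∈ φ ↔ σ x ∉ φ

variable {Γ : Type*} [Group Γ]

/-- A CM type on the group `Γ` relative to the element `c`: exactly one of `τ`, `c * τ` lies in `φ`. -/
def IsCMType (c : Γ) (φ : Set Γ) : Prop := IsCMTypeOn (fun τ => c * τ) φ

/-- Right translate `φ * γ` of a subset of a group. -/
def rtrans (φ : Set Γ) (γ : Γ) : Set Γ := (fun τ => τ * γ) '' φ

/-- Membership in a right translate. -/
lemma mem_rtrans {φ : Set Γ} {γ τ : Γ} : τ ∈ rtrans φ γ ↔ τ * γ⁻¹ ∈ φ := by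
  constructor
  · rintro ⟨x, hx, rfl⟩
    simpa using hx
  · intro h
    exact ⟨τ * γ⁻¹, h, by simp⟩

/-- Right translation by `1` is the identity. -/
lemma rtrans_one (φ : Set Γ) : rtrans φ 1 = φ := by
  ext τ
  simp [mem_rtrans]

/-- Right translation is a right action: `(φ * γ) * γ' = φ * (γ * γ')`. -/
lemma rtrans_mul (φ : Set Γ) (γ γ' : Γ) : rtrans (rtrans φ γ) γ' = rtrans φ (γ * γ') := by
  ext τ
  simp [mem_rtrans, mul_assoc]

/-- When `c` is central, the right translate of `φ` by `c` is the left translate `c * φ`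
(the "conjugate type"). -/
lemma rtrans_central {c : Γ} (hc : ∀ x, c * x = x * c) (φ : Set Γ) :
    rtrans φ c = (fun τ => c * τ) '' φ := by
  ext τ
  constructor
  · rintro ⟨x, hx, rfl⟩
    exact ⟨x, hx, by simp [hc x]⟩
  · rintro ⟨x, hx, rfl⟩
    exact ⟨x, hx, by simp [hc x]⟩

/-- Right translation preserves CM types (left multiplication by `c` commutes with right
translation; centrality is not even needed here). -/
lemma isCMType_rtrans {c : Γ} {φ : Set Γ} (h : IsCMType c φ) (γ : Γ) :
    IsCMType c (rtrans φ γ) := by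
  intro τ
  rw [mem_rtrans, mem_rtrans, h (τ * γ⁻¹), mul_assoc]

/-- The right stabiliser `{γ | φ * γ = φ}` of a subset, as a subgroup. -/
def rstab (φ : Set Γ) : Subgroup Γ where
  carrier := {γ | rtrans φ γ = φ}
  one_mem' := rtrans_one φ
  mul_mem' := by
    intro a b ha hb
    simp only [Set.mem_setOf_eq] at ha hb ⊢
    rw [← rtrans_mul, ha, hb]
  inv_mem' := by
    intro a ha
    simp only [Set.mem_setOf_eq] at ha ⊢
    have h := rtrans_mul φ a a⁻¹
    rw [ha, mul_inv_cancel, rtrans_one] at h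
    exact h

/-- Membership in the right stabiliser. -/
lemma mem_rstab {φ : Set Γ} {γ : Γ} : γ ∈ rstab φ ↔ rtrans φ γ = φ := Iff.rfl

/-- `c` never stabilises a CM type (the conjugate type `c * φ` is disjoint from `φ`). -/
lemma c_notMem_rstab_of_isCMType [Nonempty Γ] {c : Γ} (hc : ∀ x, c * x = x * c) {φ : Set Γ}
    (h : IsCMType c φ) : c ∉ rstab φ := by
  intro hmem
  rw [mem_rstab] at hmem
  obtain ⟨τ⟩ := ‹Nonempty Γ›
  by_cases hτ : τ ∈ φ
  · have h1 : τ * c ∈ rtrans φ c := ⟨τ, hτ, rfl⟩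
    rw [hmem, ← hc τ] at h1
    exact (h τ).1 hτ h1
  · have hcτ : c * τ ∈ φ := by
      by_contra hn
      exact hτ ((h τ).2 hn)
    have h1 : (c * τ) * c ∈ rtrans φ c := ⟨c * τ, hcτ, rfl⟩
    rw [hmem, ← hc (c * τ)] at h1
    exact (h (c * τ)).1 hcτ h1

/-- A subset is stable under right multiplication by its right stabiliser. -/
lemma mem_of_mem_rstab {φ : Set Γ} {τ h : Γ} (hτ : τ ∈ φ) (hh : h ∈ rstab φ) : τ * h ∈ φ := by
  rw [mem_rstab] at hh
  have hmem : τ * h ∈ rtrans φ h := ⟨τ, hτ, rfl⟩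
  rwa [hh] at hmem

/-- Membership in `φ` only depends on the left coset modulo `rstab φ`. -/
lemma mem_iff_of_rel {φ : Set Γ} {τ τ' : Γ} (hrel : τ⁻¹ * τ' ∈ rstab φ) : τ ∈ φ ↔ τ' ∈ φ := by
  constructor
  · intro hτ
    have hmem := mem_of_mem_rstab hτ hrel
    rwa [mul_inv_cancel_left] at hmem
  · intro hτ'
    have hrel' : τ'⁻¹ * τ ∈ rstab φ := by
      have hinv := (rstab φ).inv_mem hrel
      rwa [mul_inv_rev, inv_inv] at hinv
    have hmem := mem_of_mem_rstab hτ' hrel'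
    rwa [mul_inv_cancel_left] at hmem

/-- The descended subset of the left-coset space `Γ ⧸ rstab φ`. -/
def descend (φ : Set Γ) : Set (Γ ⧸ rstab φ) := (QuotientGroup.mk : Γ → Γ ⧸ rstab φ) '' φ

/-- Membership in the descended subset. -/
lemma mk_mem_descend {φ : Set Γ} {τ : Γ} :
    ((τ : Γ) : Γ ⧸ rstab φ) ∈ descend φ ↔ τ ∈ φ := by
  constructor
  · rintro ⟨τ', hτ', heq⟩
    exact (mem_iff_of_rel (QuotientGroup.eq.mp heq)).1 hτ'
  · intro hτ
    exact ⟨τ, hτ, rfl⟩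

/-- **Descent.** The image of a CM type `φ` in `Γ ⧸ rstab φ` is a CM type for the action of `c` by
left multiplication on left cosets (well defined because the action is on the left). -/
theorem isCMType_descend {c : Γ} {φ : Set Γ} (h : IsCMType c φ) :
    IsCMTypeOn (fun x : Γ ⧸ rstab φ => c • x) (descend φ) := by
  intro x
  induction x using QuotientGroup.induction_on with
  | H τ =>
    show ((τ : Γ) : Γ ⧸ rstab φ) ∈ descend φ ↔ c • ((τ : Γ) : Γ ⧸ rstab φ) ∉ descend φ
    rw [MulAction.Quotient.smul_mk, smul_eq_mul, mk_mem_descend, mk_mem_descend]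
    exact h τ

/-- Non-vacuity: in the group `ℤˣ = {1, -1}` with `c = -1`, the subset `{1}` is a CM type. -/
example : IsCMType (-1 : ℤˣ) ({1} : Set ℤˣ) := by
  intro τ
  rcases Int.units_eq_one_or τ with rfl | rfl <;> decide

end HodgeRepro0.CMType
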